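import Summits.AtomisticToContinuum.Crystallization.Theses.DisclinationRation

/-!
# `FiveFoldRation` (stmt-AtomisticToContinuum-15799), negative side: everywhere-goodness is load-bearing

Hypothesis bookkeeping for the crux `DisclinationRation.FiveFoldRation` ("in a `δ`-separated, relatively
dense `S ⊆ ℝ³` ALL of whose sites are `1/20`-good in the alphabet {fcc, hcp, decahedral axis}, the sites
that are not `1/20`-{fcc,hcp}-good have density zero uniformly on balls"):

* `fiveFoldRation_false_without_good` — with the hypothesis "every site is alphabet-good" DELETED
  (everything else verbatim, the unused `GA` abbreviation dropped) the statement is FALSE: on the simple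
  cubic lattice `ℤ³ = Set.range intVec` (`1`-separated, covering radius `≤ 2`) every first shell
  `{z : 0 < |z − y| < 13/10·d_y}` has at most SIX points (`d_y = 1`; integer vectors of squared norm `≤ 1`),
  so NO site is `1/20`-{fcc,hcp}-good (a matching would be a bijection with a twelve-point pattern), and
  the counted set is all of `ℤ³ ∩ B̄_L(0)`, of cardinality `≥ ⌊L/2⌋³ > L³/64` — against `θ = 1/64`.
  So every proof of the crux uses `hgood` away from the axis sites themselves (of course: it is the only
  hypothesis that sees the alphabet).  The two other hypotheses (`δ`-separation, relative density) admit no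
  such witness: a counterexample to the crux without them would still need a positive density of axis sites
  in an everywhere-good set (see the crux's `Disproof.lean`, § (e)).

Negative-side support (no route item is concluded positively; no new definition); refuter seat
refuter-cdisprove-stmt-AtomisticToContinuum-15799-0, 2026-08-17.
-/

noncomputable section

namespace Summit.AtomisticToContinuum.Crystallization.Theorems.FiveFoldRation.Negative

open Literature.Geometry.DiscreteGeometry

/-- A non-zero integer vector has squared norm `≥ 1`. [folklore] -/
theorem one_le_sqNormInt_of_ne_zero {u : Fin 3 → ℤ} (hu : u ≠ 0) : 1 ≤ sqNormInt u := by
  rcases lt_or_ge 0 (sqNormInt u) with h | h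
  · exact h
  · exfalso
    unfold sqNormInt at h
    have h0 : u 0 ^ 2 = 0 := by nlinarith [sq_nonneg (u 0), sq_nonneg (u 1), sq_nonneg (u 2)]
    have h1 : u 1 ^ 2 = 0 := by nlinarith [sq_nonneg (u 0), sq_nonneg (u 1), sq_nonneg (u 2)]
    have h2 : u 2 ^ 2 = 0 := by nlinarith [sq_nonneg (u 0), sq_nonneg (u 1), sq_nonneg (u 2)]
    apply hu
    funext i
    fin_cases i <;> simp_all [pow_eq_zero_iff]

/-- **Hard core of `ℤ³`**: distinct sites are `≥ 1` apart. [folklore] -/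
theorem cubic_separated : ∀ y ∈ Set.range intVec, ∀ z ∈ Set.range intVec, y ≠ z → (1 : ℝ) ≤ dist y z := by
  rintro _ ⟨v, rfl⟩ _ ⟨w, rfl⟩ hne
  rw [dist_eq_norm, intVec_sub, norm_intVec]
  have hvw : v - w ≠ 0 := fun h => hne (by rw [sub_eq_zero.mp h])
  have h1 : (1 : ℝ) ≤ (sqNormInt (v - w) : ℝ) := by exact_mod_cast one_le_sqNormInt_of_ne_zero hvw
  simpa using Real.sqrt_le_sqrt h1

/-- **`ℤ³` is relatively dense** (covering radius `≤ 2`: round down coordinatewise). [folklore] -/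
theorem cubic_relDense : ∀ p : (EuclideanSpace ℝ (Fin 3)), ∃ y ∈ Set.range intVec, dist y p ≤ 2 := by
  intro p
  refine ⟨intVec (fun i => ⌊p i⌋), ⟨_, rfl⟩, ?_⟩
  have key : ∀ i : Fin 3, dist ((intVec (fun i => ⌊p i⌋) : (EuclideanSpace ℝ (Fin 3))) i) (p i) ^ 2 ≤ 1 := by
    intro i
    have h1 := Int.floor_le (p i)
    have h2 := Int.lt_floor_add_one (p i)
    rw [Real.dist_eq, sq_abs, intVec_apply]
    nlinarith
  rw [EuclideanSpace.dist_eq]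
  calc Real.sqrt (∑ i, dist ((intVec (fun i => ⌊p i⌋) : (EuclideanSpace ℝ (Fin 3))) i) (p i) ^ 2)
      ≤ Real.sqrt 4 := by
        apply Real.sqrt_le_sqrt
        rw [Fin.sum_univ_three]
        linarith [key 0, key 1, key 2]
    _ = 2 := by
        rw [show (4 : ℝ) = 2 ^ 2 by norm_num, Real.sqrt_sq (by norm_num)]

/-- The nearest-neighbour distance of the crux is `1` on `ℤ³`. [folklore] -/
theorem sInf_dist_cubic (v : Fin 3 → ℤ) :
    sInf ((fun z => dist z (intVec v)) '' (Set.range intVec \ {intVec v})) = 1 := by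
  apply IsLeast.csInf_eq
  constructor
  · have hd : dist (intVec (v + ![1, 0, 0])) (intVec v) = 1 := by
      rw [dist_eq_norm, intVec_sub, norm_intVec, add_sub_cancel_left, show sqNormInt ![1, 0, 0] = 1 from by decide]
      simp
    refine ⟨intVec (v + ![1, 0, 0]), ⟨⟨_, rfl⟩, ?_⟩, hd⟩
    intro h
    rw [Set.mem_singleton_iff] at h
    rw [h, dist_self] at hd
    exact zero_ne_one hd
  · rintro _ ⟨z, ⟨hz, hzy⟩, rfl⟩
    have hne : z ≠ intVec v := fun h => hzy (Set.mem_singleton_iff.mpr h)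
    simpa [dist_comm] using cubic_separated _ ⟨v, rfl⟩ _ hz hne.symm

/-- Enumeration: a non-zero vector of `{−1,0,1}³` with squared norm `≤ 1` is `±e_i`. [folklore] -/
theorem sixInt_enum (a b c : ℤ) (ha : -1 ≤ a) (ha' : a ≤ 1) (hb : -1 ≤ b) (hb' : b ≤ 1)
    (hc : -1 ≤ c) (hc' : c ≤ 1) (hne : (![a, b, c] : Fin 3 → ℤ) ≠ 0) (h1 : a ^ 2 + b ^ 2 + c ^ 2 ≤ 1) :
    (![a, b, c] : Fin 3 → ℤ) ∈ ({![1, 0, 0], ![-1, 0, 0], ![0, 1, 0], ![0, -1, 0], ![0, 0, 1], ![0, 0, -1]} :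
      Finset (Fin 3 → ℤ)) := by
  interval_cases a <;> interval_cases b <;> interval_cases c <;>
    first | decide | exact (hne (by decide)).elim | norm_num at h1

/-- **The first shell of a `ℤ³` site has at most six points** (with `d_y = 1` substituted). [folklore] -/
theorem cubic_shell_card_le (v : Fin 3 → ℤ) :
    Nat.card ↥({z : (EuclideanSpace ℝ (Fin 3)) | z ∈ Set.range intVec ∧ z ≠ intVec v ∧ dist z (intVec v) < 13 / 10 * 1} : Set (EuclideanSpace ℝ (Fin 3)))
      ≤ 6 := by
  set six : Finset (Fin 3 → ℤ) :=
    {![1, 0, 0], ![-1, 0, 0], ![0, 1, 0], ![0, -1, 0], ![0, 0, 1], ![0, 0, -1]} with hsix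
  have hsub : ({z : (EuclideanSpace ℝ (Fin 3)) | z ∈ Set.range intVec ∧ z ≠ intVec v ∧ dist z (intVec v) < 13 / 10 * 1} : Set (EuclideanSpace ℝ (Fin 3)))
      ⊆ (fun u : Fin 3 → ℤ => intVec (v + u)) '' (six : Set (Fin 3 → ℤ)) := by
    rintro _ ⟨⟨w, rfl⟩, hne, hd⟩
    rw [dist_eq_norm, intVec_sub, norm_intVec] at hd
    have hwv : w - v ≠ 0 := fun h => hne (by rw [sub_eq_zero.mp h])
    have h0 : (0 : ℝ) ≤ sqNormInt (w - v) := by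
      have : 0 ≤ sqNormInt (w - v) := by unfold sqNormInt; positivity
      exact_mod_cast this
    have h2r : (sqNormInt (w - v) : ℝ) < 2 := by
      have hsq := Real.sq_sqrt h0
      have hp : 0 ≤ Real.sqrt (sqNormInt (w - v) : ℝ) := Real.sqrt_nonneg _
      nlinarith
    have h2 : sqNormInt (w - v) < 2 := by exact_mod_cast h2r
    have hmem : w - v ∈ six := by
      have hu' : w - v = ![(w - v) 0, (w - v) 1, (w - v) 2] := by funext i; fin_cases i <;> rfl
      rw [hu'] at hwv ⊢
      unfold sqNormInt at h2
      rw [hsix]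
      apply sixInt_enum _ _ _ _ _ _ _ _ _ hwv <;>
        nlinarith [sq_nonneg ((w - v) 0), sq_nonneg ((w - v) 1), sq_nonneg ((w - v) 2)]
    exact ⟨w - v, hmem, by show intVec (v + (w - v)) = intVec w; rw [add_sub_cancel]⟩
  have hfin : ((fun u : Fin 3 → ℤ => intVec (v + u)) '' (six : Set (Fin 3 → ℤ))).Finite :=
    (Finset.finite_toSet six).image _
  calc Nat.card ↥({z : (EuclideanSpace ℝ (Fin 3)) | z ∈ Set.range intVec ∧ z ≠ intVec v ∧ dist z (intVec v) < 13 / 10 * 1} : Set (EuclideanSpace ℝ (Fin 3)))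
      = ({z : (EuclideanSpace ℝ (Fin 3)) | z ∈ Set.range intVec ∧ z ≠ intVec v ∧ dist z (intVec v) < 13 / 10 * 1} : Set (EuclideanSpace ℝ (Fin 3))).ncard :=
        (Set.ncard_def _).symm
    _ ≤ ((fun u : Fin 3 → ℤ => intVec (v + u)) '' (six : Set (Fin 3 → ℤ))).ncard :=
        Set.ncard_le_ncard hsub hfin
    _ ≤ (six : Set (Fin 3 → ℤ)).ncard := Set.ncard_image_le (Finset.finite_toSet six)
    _ = six.card := Set.ncard_coe_finset six
    _ ≤ 6 := by rw [hsix]; decide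

/-- **No site of `ℤ³` is `1/20`-{fcc,hcp}-good** (the crux's inline `GF`, verbatim with `S := ℤ³`): its
first shell has `≤ 6 < 12` points. [folklore] -/
theorem cubic_not_GF : ∀ y ∈ Set.range intVec, ¬ (let d : ℝ := sInf ((fun z => dist z y) '' (Set.range intVec \ {y})); let T : Set (EuclideanSpace ℝ (Fin 3)) := {z : EuclideanSpace ℝ (Fin 3) | z ∈ Set.range intVec ∧ z ≠ y ∧ dist z y < 13 / 10 * d}; ∃ A : EuclideanSpace ℝ (Fin 3) →ₗᵢ[ℝ] EuclideanSpace ℝ (Fin 3), (∃ e : ↥T ≃ ↥Literature.Geometry.DiscreteGeometry.fccKissingPattern, ∀ t : ↥T, dist (d⁻¹ • ((t : EuclideanSpace ℝ (Fin 3)) - y)) (A ((e t : ↥Literature.Geometry.DiscreteGeometry.fccKissingPattern) : EuclideanSpace ℝ (Fin 3))) ≤ 1 / 20) ∨ (∃ e : ↥T ≃ ↥Literature.Geometry.DiscreteGeometry.hcpKissingPattern, ∀ t : ↥T, dist (d⁻¹ • ((t : EuclideanSpace ℝ (Fin 3)) - y)) (A ((e t : ↥Literature.Geometry.DiscreteGeometry.hcpKissingPattern)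 : EuclideanSpace ℝ (Fin 3))) ≤ 1 / 20)) := by
  rintro _ ⟨v, rfl⟩
  show ¬ ∃ A : EuclideanSpace ℝ (Fin 3) →ₗᵢ[ℝ] EuclideanSpace ℝ (Fin 3), _
  rw [sInf_dist_cubic v]
  have h6 := cubic_shell_card_le v
  rintro ⟨A, ⟨e, -⟩ | ⟨e, -⟩⟩
  · have h12 := Nat.card_congr e
    rw [Nat.card_eq_fintype_card (α := ↥fccKissingPattern), Fintype.card_coe, card_fccKissingPattern] at h12
    omega
  · have h12 := Nat.card_congr e
    rw [Nat.card_eq_fintype_card (α := ↥hcpKissingPattern), Fintype.card_coe, card_hcpKissingPattern] at h12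
    omega

/-- The sites of `ℤ³` in a ball form a finite set. [folklore] -/
theorem cubic_ball_finite (L : ℝ) :
    ({y : (EuclideanSpace ℝ (Fin 3)) | y ∈ Set.range intVec ∧ dist y 0 ≤ L} : Set (EuclideanSpace ℝ (Fin 3))).Finite := by
  have hbox : (Set.pi Set.univ (fun _ : Fin 3 => Set.Icc (-⌈L⌉) ⌈L⌉)).Finite :=
    Set.Finite.pi fun _ => Set.finite_Icc _ _
  refine (hbox.image intVec).subset ?_
  rintro _ ⟨⟨v, rfl⟩, hd⟩
  refine ⟨v, ?_, rfl⟩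
  simp only [Set.mem_pi, Set.mem_univ, true_implies, Set.mem_Icc]
  intro i
  rw [dist_zero_right, norm_intVec] at hd
  have hL0 : 0 ≤ L := le_trans (Real.sqrt_nonneg _) hd
  have h0 : (0 : ℝ) ≤ sqNormInt v := by
    have : 0 ≤ sqNormInt v := by unfold sqNormInt; positivity
    exact_mod_cast this
  have hsq : (sqNormInt v : ℝ) ≤ L ^ 2 := by
    have := Real.sq_sqrt h0
    have hp : 0 ≤ Real.sqrt (sqNormInt v : ℝ) := Real.sqrt_nonneg _
    nlinarith
  have k0 : (v 0) ^ 2 ≤ sqNormInt v := by unfold sqNormInt; nlinarith [sq_nonneg (v 1), sq_nonneg (v 2)]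
  have k1 : (v 1) ^ 2 ≤ sqNormInt v := by unfold sqNormInt; nlinarith [sq_nonneg (v 0), sq_nonneg (v 2)]
  have k2 : (v 2) ^ 2 ≤ sqNormInt v := by unfold sqNormInt; nlinarith [sq_nonneg (v 0), sq_nonneg (v 1)]
  have hvi : ((v i) ^ 2 : ℤ) ≤ sqNormInt v := by
    fin_cases i <;> [exact k0; exact k1; exact k2]
  have hvi' : ((v i : ℝ)) ^ 2 ≤ L ^ 2 := by
    have : (((v i) ^ 2 : ℤ) : ℝ) ≤ (sqNormInt v : ℝ) := by exact_mod_cast hvi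
    push_cast at this
    linarith
  have habs : |(v i : ℝ)| ≤ L := abs_le_of_sq_le_sq' hvi' hL0 |> fun h => abs_le.mpr h
  have hc := Int.le_ceil L
  obtain ⟨h1, h2⟩ := abs_le.mp habs
  constructor
  · have : ((-⌈L⌉ : ℤ) : ℝ) ≤ (v i : ℝ) := by push_cast; linarith
    exact_mod_cast this
  · have : (v i : ℝ) ≤ ((⌈L⌉ : ℤ) : ℝ) := by linarith
    exact_mod_cast this

/-- **Counting**: `ℤ³ ∩ B̄_L(0)` has more than `L³/64` sites for `L ≥ 8` (it contains the cube
`{0,…,⌊L/2⌋₊−1}³`). [folklore] -/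
theorem cubic_ball_count {L : ℝ} (hL8 : 8 ≤ L) :
    1 / 64 * L ^ 3 < ((({y : (EuclideanSpace ℝ (Fin 3)) | y ∈ Set.range intVec ∧ dist y 0 ≤ L} : Set (EuclideanSpace ℝ (Fin 3))).ncard : ℕ) : ℝ) := by
  have hL0 : (0 : ℝ) ≤ L := by linarith
  obtain ⟨m, hm⟩ : ∃ m : ℕ, m = ⌊L / 2⌋₊ := ⟨_, rfl⟩
  have hmL : (m : ℝ) ≤ L / 2 := hm ▸ Nat.floor_le (by linarith)
  have hmL' : L / 2 < (m : ℝ) + 1 := hm ▸ Nat.lt_floor_add_one (L / 2)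
  have hcount : (Set.univ : Set (Fin m × Fin m × Fin m)).ncard
      ≤ ({y : (EuclideanSpace ℝ (Fin 3)) | y ∈ Set.range intVec ∧ dist y 0 ≤ L} : Set (EuclideanSpace ℝ (Fin 3))).ncard := by
    refine Set.ncard_le_ncard_of_injOn
      (fun a : Fin m × Fin m × Fin m => intVec ![((a.1 : ℕ) : ℤ), ((a.2.1 : ℕ) : ℤ), ((a.2.2 : ℕ) : ℤ)])
      ?_ ?_ (cubic_ball_finite L)
    · rintro ⟨a, b, c⟩ -
      refine ⟨⟨_, rfl⟩, ?_⟩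
      rw [dist_zero_right, norm_intVec]
      have ha : ((a : ℕ) : ℝ) + 1 ≤ m := by exact_mod_cast a.isLt
      have hb : ((b : ℕ) : ℝ) + 1 ≤ m := by exact_mod_cast b.isLt
      have hc : ((c : ℕ) : ℝ) + 1 ≤ m := by exact_mod_cast c.isLt
      have ha0 : (0 : ℝ) ≤ ((a : ℕ) : ℝ) := by positivity
      have hb0 : (0 : ℝ) ≤ ((b : ℕ) : ℝ) := by positivity
      have hc0 : (0 : ℝ) ≤ ((c : ℕ) : ℝ) := by positivity
      have hs : (sqNormInt ![((a : ℕ) : ℤ), ((b : ℕ) : ℤ), ((c : ℕ) : ℤ)] : ℝ)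
          = ((a : ℕ) : ℝ) ^ 2 + ((b : ℕ) : ℝ) ^ 2 + ((c : ℕ) : ℝ) ^ 2 := by
        simp [sqNormInt]
      rw [hs, ← Real.sqrt_sq hL0]
      apply Real.sqrt_le_sqrt
      nlinarith
    · rintro ⟨a, b, c⟩ - ⟨a', b', c'⟩ - hab
      have h := intVec_injective hab
      have h0 : (a : ℕ) = a' := by simpa using congrFun h 0
      have h1 : (b : ℕ) = b' := by simpa using congrFun h 1
      have h2 : (c : ℕ) = c' := by simpa using congrFun h 2
      rw [Fin.ext h0, Fin.ext h1, Fin.ext h2]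
  have huniv : (Set.univ : Set (Fin m × Fin m × Fin m)).ncard = m * m * m := by
    rw [Set.ncard_univ, Nat.card_eq_fintype_card]
    simp [Fintype.card_prod, Fintype.card_fin, mul_assoc]
  have hm3 : ((m : ℝ)) ^ 3 ≤ ((({y : (EuclideanSpace ℝ (Fin 3)) | y ∈ Set.range intVec ∧ dist y 0 ≤ L} : Set (EuclideanSpace ℝ (Fin 3))).ncard : ℕ) : ℝ) := by
    have : m * m * m ≤ ({y : (EuclideanSpace ℝ (Fin 3)) | y ∈ Set.range intVec ∧ dist y 0 ≤ L} : Set (EuclideanSpace ℝ (Fin 3))).ncard := huniv ▸ hcount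
    have := (Nat.cast_le (α := ℝ)).mpr this
    push_cast at this
    nlinarith [this]
  have hm4 : L / 4 < (m : ℝ) := by linarith
  have hm0 : (0 : ℝ) ≤ L / 4 := by linarith
  have hlt : (L / 4) ^ 3 < (m : ℝ) ^ 3 := pow_lt_pow_left₀ hm4 hm0 (by norm_num)
  nlinarith

/-- **Counting against the density bound**: if NO site of `ℤ³` satisfies `P`, the set
`{y ∈ ℤ³ ∩ B̄_L(0) : ¬ P y}` cannot have `≤ L³/64` elements once `L ≥ 8`. [folklore] -/
theorem cubic_count_contra (P : (EuclideanSpace ℝ (Fin 3)) → Prop) {L : ℝ} (hL8 : 8 ≤ L)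
    (hkey : ((({y : (EuclideanSpace ℝ (Fin 3)) | y ∈ Set.range intVec ∧ dist y 0 ≤ L ∧ ¬ P y} : Set (EuclideanSpace ℝ (Fin 3))).ncard : ℕ) : ℝ) ≤ 1 / 64 * L ^ 3)
    (hP : ∀ y ∈ Set.range intVec, ¬ P y) : False := by
  have hset : ({y : (EuclideanSpace ℝ (Fin 3)) | y ∈ Set.range intVec ∧ dist y 0 ≤ L ∧ ¬ P y} : Set (EuclideanSpace ℝ (Fin 3)))
      = {y : (EuclideanSpace ℝ (Fin 3)) | y ∈ Set.range intVec ∧ dist y 0 ≤ L} := by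
    ext y
    constructor
    · rintro ⟨hy, hd, -⟩; exact ⟨hy, hd⟩
    · rintro ⟨hy, hd⟩; exact ⟨hy, hd, hP y hy⟩
  rw [hset] at hkey
  have := cubic_ball_count hL8
  linarith

/-- **Everywhere-goodness is load-bearing**: `FiveFoldRation` with the hypothesis `∀ y ∈ S, GA S y`
deleted (verbatim otherwise; the then-unused abbreviation `GA` dropped) is FALSE — witness `S = ℤ³`,
`δ = 1`, `θ = 1/64`, centre `0`, radius `max L₀ 8`. [folklore] -/
theorem fiveFoldRation_false_without_good : ¬ (let GF : Set (EuclideanSpace ℝ (Fin 3)) → EuclideanSpace ℝ (Fin 3) → Prop := fun S y => let d : ℝ := sInf ((fun z => dist z y) '' (S \ {y})); let T : Set (EuclideanSpace ℝ (Fin 3)) := {z : EuclideanSpace ℝ (Fin 3) | z ∈ S ∧ z ≠ y ∧ dist z y < 13 / 10 * d}; ∃ A : EuclideanSpace ℝ (Fin 3) →ₗᵢ[ℝ] EuclideanSpace ℝ (Fin 3), (∃ e : ↥T ≃ ↥Literature.Geometry.DiscreteGeometry.fccKissingPattern, ∀ t : ↥T, dist (d⁻¹ • ((t : EuclideanSpace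 ℝ (Fin 3)) - y)) (A ((e t : ↥Literature.Geometry.DiscreteGeometry.fccKissingPattern) : EuclideanSpace ℝ (Fin 3))) ≤ 1 / 20) ∨ (∃ e : ↥T ≃ ↥Literature.Geometry.DiscreteGeometry.hcpKissingPattern, ∀ t : ↥T, dist (d⁻¹ • ((t : EuclideanSpace ℝ (Fin 3)) - y)) (A ((e t : ↥Literature.Geometry.DiscreteGeometry.hcpKissingPattern) : EuclideanSpace ℝ (Fin 3))) ≤ 1 / 20); ∀ δ : ℝ, 0 < δ → ∀ S : Set (EuclideanSpace ℝ (Fin 3)), (∀ y ∈ S, ∀ z ∈ S, y ≠ z → δ ≤ dist y z) → (∃ R₁ : ℝ, ∀ p : EuclideanSpace ℝ (Fin 3), ∃ y ∈ S, dist y p ≤ R₁) → (∀ θ : ℝ, 0 < θ → ∃ L₀ : ℝ, ∀ L : ℝ, L₀ ≤ L → ∀ c : EuclideanSpace ℝ (Fin 3), (({y : EuclideanSpace ℝ (Fin 3) | y ∈ S ∧ dist y c ≤ L ∧ ¬ GF S y} : Set (EuclideanSpace ℝ (Fin 3))).ncard : ℝ) ≤ θ * L ^ 3)) := by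
  intro h
  obtain ⟨L₀, hL₀⟩ := h 1 one_pos (Set.range intVec) cubic_separated ⟨2, cubic_relDense⟩ (1 / 64) (by norm_num)
  exact cubic_count_contra _ (le_max_right L₀ 8) (hL₀ (max L₀ 8) (le_max_left _ _) 0) cubic_not_GF

end Summit.AtomisticToContinuum.Crystallization.Theorems.FiveFoldRation.Negative

end
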